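import Mathlib
import HarnessLib
import Summits.Ventures.LatticeQCDFlow.Exactness.SU2ResidualSmoothStencilVolumeUniform

/-!
# THE ENGINE'S PARAMETRISATION WITH A SMOOTH NETWORK ON MASKED RAW FEATURES, END TO END — EVERY STRUCTURAL HYPOTHESIS DISCHARGED: weights `(κ_t/(2(d−1)))·tanh` of a window-stencil network `Ψ` reading a raw per-site feature map `g` of the plaquettes MASKED TO THE FROZEN ONES; what remains is smoothness + measurability of `Ψ` and `g` and the refusal budget `|c_s|κ_t ≤ κ₀ < 1`; FT-HMC through the learned `SU(2)` residual member with the exact force as run converges below ONE `τ₀` on EVERY torus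

HONEST FRAMING: exact (Metropolis-corrected) sampling algorithms for lattice gauge theory;
figures of merit are autocorrelation/cost numbers at stated couplings and volumes; no
continuum-physics claim.

Venture `LatticeQCDFlow` (cell pub-lqcd), topic `Exactness`; FANOUT row 14 (`eng-flowhmc`, engine
`latflow.fthmc`, family B; `maps.residual_context_flat`: per-site `(Re, Im) tr` features of the plaquettes,
masked to the frozen ones by the site's phase and the layer's direction/phase; `maps.residual_scan_rho`:
`(kappa/Jn) tanh(CNN(features))`).  NEW WORK of the cell over the tree
(`SU2ResidualSmoothStencilVolumeUniform`: the same conclusion for an abstract feature map `feat` with the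
frozen-feature property `hfeat` as a hypothesis; `LatticeStencilSmooth` §4: for MASKED feature maps
`feat s c P = g s c ((μ',ν') ↦ if frozen_s(c, μ', ν') then P μ' ν' else 1)` — frozen = off-diagonal plane
without `μf s`, or colour `c ∉ {bf s, bf s − 1}` — `hfeat` holds BY CONSTRUCTION and smoothness /
measurability reduce to the raw map `g`); nothing is cited as a fact; no number.  GEN-17, final corollary.

* **`su2ResidualMaskedStencil_member_fthmcN_exactForce_uniformlyErgodic_allVolumes`** — phase masks of
  width `w > 1`, ANY schedule with `|c_s|·κ_t ≤ κ₀ < 1` (`0 ≤ κ_t`), ANY raw feature map `g` and raw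
  readout `Ψ` that are measurable and differentiable / `C^n` along coordinatewise-differentiable / `C^n`
  families (gD)/(gC)/(ΨD)/(ΨC), every `β, κ, κ' > 0`: THERE IS `τ₀ > 0` such that FOR EVERY side `L` with
  `w ∣ L` the learned member with the weights VERBATIM exists, its exact force is measurable, and for every
  `n ≥ 1`, `ε' > 0` with `nε' ≤ τ₀` the reported `n`-step FT-HMC kernel with the exact force as run
  converges to `wilsonMeasure SU(2).subtype β` from EVERY start, geometrically in total variation.

WHAT REMAINS A HYPOTHESIS, honestly: smoothness of `Ψ`, `g` along smooth families (smooth activations —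
NOT the engine's LeakyReLU default) and their measurability; that the checkpoint's preprocessing IS this
mask rule.  NOT CLAIMED: values of `τ₀`; a volume-uniform rate; longer trajectories; OMF; floating point;
any number.
-/

noncomputable section

namespace Summit.Ventures.LatticeQCDFlow.Exactness

open Set Function MeasureTheory ProbabilityTheory ProbabilityTheory.Kernel InnerProductGeometry WithLp NormedSpace
open Literature.MathematicalPhysics.QuantumFieldTheory
open Literature.MathematicalPhysics.QuantumFieldTheory.Balaban1983to89.B10Eq18SigmaSU2Haar (expPauli)
open scoped ENNReal Matrix Matrix.Norms.Operator NNReal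

set_option backward.isDefEq.respectTransparency false

section Masked

variable {d : ℕ} {σ : Type*} {Φ : Type*} [NormedAddCommGroup Φ] [NormedSpace ℝ Φ] [MeasurableSpace Φ]

/-- **THE ENGINE'S PARAMETRISATION ON MASKED RAW FEATURES, END TO END** (`ρ = (κ_t/(2(d−1)))·tanh ∘ Ψ` of
the window of `g` applied to the frozen-masked plaquettes): every structural hypothesis of the GEN-16 chain
is discharged — what remains is smoothness and measurability OF THE RAW MAPS `Ψ`, `g` and the refusal
budget `|c_s|κ_t ≤ κ₀ < 1`. -/
theorem su2ResidualMaskedStencil_member_fthmcN_exactForce_uniformlyErgodic_allVolumes (w : ℕ) [Fact (1 < w)]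
    (μf : σ → Fin d) (bf : σ → ZMod w) (cf : σ → ℝ) (m : ℕ)
    (g : σ → ZMod w → (Fin d → Fin d → Matrix.specialUnitaryGroup (Fin 2) ℂ) → Φ)
    (Ψ : σ → Fin d → Fin d → Fin 2 → ({z : Fin d → ℤ // ∀ i, |z i| ≤ ((m : ℕ) : ℤ)} → Φ) → ℝ)
    {κt : ℝ} (hκt : 0 ≤ κt) {κ₀ : ℝ} (hκ0 : 0 ≤ κ₀) (hκ₀ : κ₀ < 1) (hcκ : ∀ s : σ, |cf s| * κt ≤ κ₀)
    (hgD : ∀ (P : Type) [NormedAddCommGroup P] [NormedSpace ℝ P] (s : σ) (c : ZMod w)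
      (Pl : P → Fin d → Fin d → Matrix.specialUnitaryGroup (Fin 2) ℂ) (q₀ : P),
      (∀ μ' ν' : Fin d, DifferentiableAt ℝ (fun q : P => ((Pl q μ' ν' : (Matrix.specialUnitaryGroup (Fin 2) ℂ)) : Matrix (Fin 2) (Fin 2) ℂ)) q₀) →
      DifferentiableAt ℝ (fun q : P => g s c (Pl q)) q₀)
    (hgC : ∀ (P : Type) [NormedAddCommGroup P] [NormedSpace ℝ P] {n : WithTop ℕ∞} (s : σ) (c : ZMod w)
      (Pl : P → Fin d → Fin d → Matrix.specialUnitaryGroup (Fin 2) ℂ) (q₀ : P),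
      (∀ μ' ν' : Fin d, ContDiffAt ℝ n (fun q : P => ((Pl q μ' ν' : (Matrix.specialUnitaryGroup (Fin 2) ℂ)) : Matrix (Fin 2) (Fin 2) ℂ)) q₀) →
      ContDiffAt ℝ n (fun q : P => g s c (Pl q)) q₀)
    (hΨD : ∀ (P : Type) [NormedAddCommGroup P] [NormedSpace ℝ P] (s : σ) (μ ν : Fin d) (t : Fin 2)
      (G : P → {z : Fin d → ℤ // ∀ i, |z i| ≤ ((m : ℕ) : ℤ)} → Φ) (q₀ : P),
      (∀ z, DifferentiableAt ℝ (fun q : P => G q z) q₀) → DifferentiableAt ℝ (fun q : P => Ψ s μ ν t (G q)) q₀)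
    (hΨC : ∀ (P : Type) [NormedAddCommGroup P] [NormedSpace ℝ P] {n : WithTop ℕ∞} (s : σ) (μ ν : Fin d) (t : Fin 2)
      (G : P → {z : Fin d → ℤ // ∀ i, |z i| ≤ ((m : ℕ) : ℤ)} → Φ) (q₀ : P),
      (∀ z, ContDiffAt ℝ n (fun q : P => G q z) q₀) → ContDiffAt ℝ n (fun q : P => Ψ s μ ν t (G q)) q₀)
    (hgm : ∀ (s : σ) (c : ZMod w), Measurable (g s c))
    (hΨm : ∀ (s : σ) (μ ν : Fin d) (t : Fin 2), Measurable (Ψ s μ ν t))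
    (sched : List σ) (β κ : ℝ) {κ' : ℝ} (hκ' : 0 < κ') :
    ∃ τ₀ : ℝ, 0 < τ₀ ∧ ∀ (L : ℕ) [NeZero L] (hwL : w ∣ L),
    ∃ layers : List ((GaugeConfig d L (Matrix.specialUnitaryGroup (Fin 2) ℂ) ≃ᵐ GaugeConfig d L (Matrix.specialUnitaryGroup (Fin 2) ℂ)) × (GaugeConfig d L (Matrix.specialUnitaryGroup (Fin 2) ℂ) → ℝ)),
      layers.map (fun Ly => ((Ly.1 : GaugeConfig d L (Matrix.specialUnitaryGroup (Fin 2) ℂ) → GaugeConfig d L (Matrix.specialUnitaryGroup (Fin 2) ℂ)), Ly.2)) =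
        sched.map (fun s =>
          ((fun (V : GaugeConfig d L (Matrix.specialUnitaryGroup (Fin 2) ℂ)) (e : Edge d L) =>
        if e.2 = μf s ∧ (ZMod.castHom hwL (ZMod w) (∑ j, e.1 j)) = bf s then
          gaussUnit (geodesicKick (cf s) (∑ ν ∈ Finset.univ.erase e.2,
            (((fun s μ ν t F => κt / (2 * ((d - 1 : ℕ) : ℝ)) * Real.tanh (Ψ s μ ν t F)) s e.2 ν 0 (fun z : {z : Fin d → ℤ // ∀ i, |z i| ≤ ((m : ℕ) : ℤ)} =>
          (fun (s : σ) (c : ZMod w) (P : Fin d → Fin d → Matrix.specialUnitaryGroup (Fin 2) ℂ) => g s c (fun μ' ν' => if μ' ≠ ν' ∧ ((μf s ≠ μ' ∧ μf s ≠ ν') ∨ (c ≠ bf s ∧ c + 1 ≠ bf s)) then P μ' ν' else 1)) s (ZMod.cast (∑ j, (e.1 + (fun i => ((z.1 i : ℤ) : ZMod L))) j) : ZMod w) (fun μ' ν' => plaquetteHolonomy V (e.1 + (fun i => ((z.1 i : ℤ) : ZMod L))) μ' ν'))) • vecQuat (((V (Site.shift e.1 e.2, ν) * (V (Site.shift e.1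 ν, e.2))⁻¹ * (V (e.1, ν))⁻¹)⁻¹ : Matrix.specialUnitaryGroup (Fin 2) ℂ) : Matrix (Fin 2) (Fin 2) ℂ) +
              ((fun s μ ν t F => κt / (2 * ((d - 1 : ℕ) : ℝ)) * Real.tanh (Ψ s μ ν t F)) s e.2 ν 1 (fun z : {z : Fin d → ℤ // ∀ i, |z i| ≤ ((m : ℕ) : ℤ)} =>
          (fun (s : σ) (c : ZMod w) (P : Fin d → Fin d → Matrix.specialUnitaryGroup (Fin 2) ℂ) => g s c (fun μ' ν' => if μ' ≠ ν' ∧ ((μf s ≠ μ' ∧ μf s ≠ ν') ∨ (c ≠ bf s ∧ c + 1 ≠ bf s)) then P μ' ν' else 1)) s (ZMod.cast (∑ j, (e.1 + (fun i => ((z.1 i : ℤ) : ZMod L))) j) : ZMod w) (fun μ' ν' => plaquetteHolonomy V (e.1 + (fun i => ((z.1 i : ℤ) : ZMod L))) μ' ν'))) • vecQuat ((((V (Site.shift (e.1 - Pi.single ν 1) e.2, ν))⁻¹ * (V (e.1 - Pi.single ν 1, e.2))⁻¹ * V (e.1 - Pi.single ν 1, ν))⁻¹ : Matrix.specialUnitaryGroup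 (Fin 2) ℂ) : Matrix (Fin 2) (Fin 2) ℂ)))
            (vecQuat ((V e : Matrix.specialUnitaryGroup (Fin 2) ℂ) : Matrix (Fin 2) (Fin 2) ℂ)))
        else V e),
           fun V : GaugeConfig d L (Matrix.specialUnitaryGroup (Fin 2) ℂ) => ∏ a : {e : Edge d L // e.2 = μf s ∧ (ZMod.castHom hwL (ZMod w) (∑ j, e.1 j)) = bf s},
          (if Real.sin (angle (∑ ν ∈ Finset.univ.erase a.1.2,
            (((fun s μ ν t F => κt / (2 * ((d - 1 : ℕ) : ℝ)) * Real.tanh (Ψ s μ ν t F)) s a.1.2 ν 0 (fun z : {z : Fin d → ℤ // ∀ i, |z i| ≤ ((m : ℕ) : ℤ)} =>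
          (fun (s : σ) (c : ZMod w) (P : Fin d → Fin d → Matrix.specialUnitaryGroup (Fin 2) ℂ) => g s c (fun μ' ν' => if μ' ≠ ν' ∧ ((μf s ≠ μ' ∧ μf s ≠ ν') ∨ (c ≠ bf s ∧ c + 1 ≠ bf s)) then P μ' ν' else 1)) s (ZMod.cast (∑ j, (a.1.1 + (fun i => ((z.1 i : ℤ) : ZMod L))) j) : ZMod w) (fun μ' ν' => plaquetteHolonomy V (a.1.1 + (fun i => ((z.1 i : ℤ) : ZMod L))) μ' ν'))) • vecQuat (((V (Site.shift a.1.1 a.1.2, ν) * (V (Site.shift a.1.1 ν, a.1.2))⁻¹ * (V (a.1.1, ν))⁻¹)⁻¹ : Matrix.specialUnitaryGroup (Fin 2) ℂ) : Matrix (Fin 2) (Fin 2) ℂ) +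
              ((fun s μ ν t F => κt / (2 * ((d - 1 : ℕ) : ℝ)) * Real.tanh (Ψ s μ ν t F)) s a.1.2 ν 1 (fun z : {z : Fin d → ℤ // ∀ i, |z i| ≤ ((m : ℕ) : ℤ)} =>
          (fun (s : σ) (c : ZMod w) (P : Fin d → Fin d → Matrix.specialUnitaryGroup (Fin 2) ℂ) => g s c (fun μ' ν' => if μ' ≠ ν' ∧ ((μf s ≠ μ' ∧ μf s ≠ ν') ∨ (c ≠ bf s ∧ c + 1 ≠ bf s)) then P μ' ν' else 1)) s (ZMod.cast (∑ j, (a.1.1 + (fun i => ((z.1 i : ℤ) : ZMod L))) j) : ZMod w) (fun μ' ν' => plaquetteHolonomy V (a.1.1 + (fun i => ((z.1 i : ℤ) : ZMod L))) μ' ν'))) • vecQuat ((((V (Site.shift (a.1.1 - Pi.single ν 1) a.1.2, ν))⁻¹ * (V (a.1.1 - Pi.single ν 1, a.1.2))⁻¹ * V (a.1.1 - Pi.single ν 1, ν))⁻¹ : Matrix.specialUnitaryGroup (Fin 2) ℂ) : Matrix (Fin 2) (Fin 2) ℂ))) (vecQuat ((V a.1 : Matrix.specialUnitaryGroup (Fin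 2) ℂ) : Matrix (Fin 2) (Fin 2) ℂ))) = 0 then
            (1 - cf s * ‖(∑ ν ∈ Finset.univ.erase a.1.2,
            (((fun s μ ν t F => κt / (2 * ((d - 1 : ℕ) : ℝ)) * Real.tanh (Ψ s μ ν t F)) s a.1.2 ν 0 (fun z : {z : Fin d → ℤ // ∀ i, |z i| ≤ ((m : ℕ) : ℤ)} =>
          (fun (s : σ) (c : ZMod w) (P : Fin d → Fin d → Matrix.specialUnitaryGroup (Fin 2) ℂ) => g s c (fun μ' ν' => if μ' ≠ ν' ∧ ((μf s ≠ μ' ∧ μf s ≠ ν') ∨ (c ≠ bf s ∧ c + 1 ≠ bf s)) then P μ' ν' else 1)) s (ZMod.cast (∑ j, (a.1.1 + (fun i => ((z.1 i : ℤ) : ZMod L))) j) : ZMod w) (fun μ' ν' => plaquetteHolonomy V (a.1.1 + (fun i => ((z.1 i : ℤ) : ZMod L))) μ' ν'))) • vecQuat (((V (Site.shift a.1.1 a.1.2, ν) * (V (Site.shift a.1.1 ν, a.1.2))⁻¹ * (V (a.1.1, ν))⁻¹)⁻¹ : Matrix.specialUnitaryGroup (Fin 2) ℂ) : Matrix (Fin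 2) (Fin 2) ℂ) +
              ((fun s μ ν t F => κt / (2 * ((d - 1 : ℕ) : ℝ)) * Real.tanh (Ψ s μ ν t F)) s a.1.2 ν 1 (fun z : {z : Fin d → ℤ // ∀ i, |z i| ≤ ((m : ℕ) : ℤ)} =>
          (fun (s : σ) (c : ZMod w) (P : Fin d → Fin d → Matrix.specialUnitaryGroup (Fin 2) ℂ) => g s c (fun μ' ν' => if μ' ≠ ν' ∧ ((μf s ≠ μ' ∧ μf s ≠ ν') ∨ (c ≠ bf s ∧ c + 1 ≠ bf s)) then P μ' ν' else 1)) s (ZMod.cast (∑ j, (a.1.1 + (fun i => ((z.1 i : ℤ) : ZMod L))) j) : ZMod w) (fun μ' ν' => plaquetteHolonomy V (a.1.1 + (fun i => ((z.1 i : ℤ) : ZMod L))) μ' ν'))) • vecQuat ((((V (Site.shift (a.1.1 - Pi.single ν 1) a.1.2, ν))⁻¹ * (V (a.1.1 - Pi.single ν 1, a.1.2))⁻¹ * V (a.1.1 - Pi.single ν 1, ν))⁻¹ : Matrix.specialUnitaryGroup (Fin 2) ℂ) : Matrix (Fin 2) (Fin 2) ℂ)))‖ * Real.cos (angle (∑ ν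 ∈ Finset.univ.erase a.1.2,
            (((fun s μ ν t F => κt / (2 * ((d - 1 : ℕ) : ℝ)) * Real.tanh (Ψ s μ ν t F)) s a.1.2 ν 0 (fun z : {z : Fin d → ℤ // ∀ i, |z i| ≤ ((m : ℕ) : ℤ)} =>
          (fun (s : σ) (c : ZMod w) (P : Fin d → Fin d → Matrix.specialUnitaryGroup (Fin 2) ℂ) => g s c (fun μ' ν' => if μ' ≠ ν' ∧ ((μf s ≠ μ' ∧ μf s ≠ ν') ∨ (c ≠ bf s ∧ c + 1 ≠ bf s)) then P μ' ν' else 1)) s (ZMod.cast (∑ j, (a.1.1 + (fun i => ((z.1 i : ℤ) : ZMod L))) j) : ZMod w) (fun μ' ν' => plaquetteHolonomy V (a.1.1 + (fun i => ((z.1 i : ℤ) : ZMod L))) μ' ν'))) • vecQuat (((V (Site.shift a.1.1 a.1.2, ν) * (V (Site.shift a.1.1 ν, a.1.2))⁻¹ * (V (a.1.1, ν))⁻¹)⁻¹ : Matrix.specialUnitaryGroup (Fin 2) ℂ) : Matrix (Fin 2) (Fin 2) ℂ) +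
              ((fun s μ ν t F => κt / (2 * ((d - 1 : ℕ) : ℝ)) * Real.tanh (Ψ s μ ν t F)) s a.1.2 ν 1 (fun z : {z : Fin d → ℤ // ∀ i, |z i| ≤ ((m : ℕ) : ℤ)} =>
          (fun (s : σ) (c : ZMod w) (P : Fin d → Fin d → Matrix.specialUnitaryGroup (Fin 2) ℂ) => g s c (fun μ' ν' => if μ' ≠ ν' ∧ ((μf s ≠ μ' ∧ μf s ≠ ν') ∨ (c ≠ bf s ∧ c + 1 ≠ bf s)) then P μ' ν' else 1)) s (ZMod.cast (∑ j, (a.1.1 + (fun i => ((z.1 i : ℤ) : ZMod L))) j) : ZMod w) (fun μ' ν' => plaquetteHolonomy V (a.1.1 + (fun i => ((z.1 i : ℤ) : ZMod L))) μ' ν'))) • vecQuat ((((V (Site.shift (a.1.1 - Pi.single ν 1) a.1.2, ν))⁻¹ * (V (a.1.1 - Pi.single ν 1, a.1.2))⁻¹ * V (a.1.1 - Pi.single ν 1, ν))⁻¹ : Matrix.specialUnitaryGroup (Fin 2) ℂ) : Matrix (Fin 2) (Fin 2) ℂ))) (vecQuat ((V a.1 : Matrix.specialUnitaryGroup (Fin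 2) ℂ) : Matrix (Fin 2) (Fin 2) ℂ)))) ^ 3
          else kickJac (cf s * ‖(∑ ν ∈ Finset.univ.erase a.1.2,
            (((fun s μ ν t F => κt / (2 * ((d - 1 : ℕ) : ℝ)) * Real.tanh (Ψ s μ ν t F)) s a.1.2 ν 0 (fun z : {z : Fin d → ℤ // ∀ i, |z i| ≤ ((m : ℕ) : ℤ)} =>
          (fun (s : σ) (c : ZMod w) (P : Fin d → Fin d → Matrix.specialUnitaryGroup (Fin 2) ℂ) => g s c (fun μ' ν' => if μ' ≠ ν' ∧ ((μf s ≠ μ' ∧ μf s ≠ ν') ∨ (c ≠ bf s ∧ c + 1 ≠ bf s)) then P μ' ν' else 1)) s (ZMod.cast (∑ j, (a.1.1 + (fun i => ((z.1 i : ℤ) : ZMod L))) j) : ZMod w) (fun μ' ν' => plaquetteHolonomy V (a.1.1 + (fun i => ((z.1 i : ℤ) : ZMod L))) μ' ν'))) • vecQuat (((V (Site.shift a.1.1 a.1.2, ν) * (V (Site.shift a.1.1 ν, a.1.2))⁻¹ * (V (a.1.1, ν))⁻¹)⁻¹ : Matrix.specialUnitaryGroup (Fin 2) ℂ) : Matrix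 (Fin 2) (Fin 2) ℂ) +
              ((fun s μ ν t F => κt / (2 * ((d - 1 : ℕ) : ℝ)) * Real.tanh (Ψ s μ ν t F)) s a.1.2 ν 1 (fun z : {z : Fin d → ℤ // ∀ i, |z i| ≤ ((m : ℕ) : ℤ)} =>
          (fun (s : σ) (c : ZMod w) (P : Fin d → Fin d → Matrix.specialUnitaryGroup (Fin 2) ℂ) => g s c (fun μ' ν' => if μ' ≠ ν' ∧ ((μf s ≠ μ' ∧ μf s ≠ ν') ∨ (c ≠ bf s ∧ c + 1 ≠ bf s)) then P μ' ν' else 1)) s (ZMod.cast (∑ j, (a.1.1 + (fun i => ((z.1 i : ℤ) : ZMod L))) j) : ZMod w) (fun μ' ν' => plaquetteHolonomy V (a.1.1 + (fun i => ((z.1 i : ℤ) : ZMod L))) μ' ν'))) • vecQuat ((((V (Site.shift (a.1.1 - Pi.single ν 1) a.1.2, ν))⁻¹ * (V (a.1.1 - Pi.single ν 1, a.1.2))⁻¹ * V (a.1.1 - Pi.single ν 1, ν))⁻¹ : Matrix.specialUnitaryGroup (Fin 2) ℂ) : Matrix (Fin 2) (Fin 2) ℂ)))‖) 2 (angle (∑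 ν ∈ Finset.univ.erase a.1.2,
            (((fun s μ ν t F => κt / (2 * ((d - 1 : ℕ) : ℝ)) * Real.tanh (Ψ s μ ν t F)) s a.1.2 ν 0 (fun z : {z : Fin d → ℤ // ∀ i, |z i| ≤ ((m : ℕ) : ℤ)} =>
          (fun (s : σ) (c : ZMod w) (P : Fin d → Fin d → Matrix.specialUnitaryGroup (Fin 2) ℂ) => g s c (fun μ' ν' => if μ' ≠ ν' ∧ ((μf s ≠ μ' ∧ μf s ≠ ν') ∨ (c ≠ bf s ∧ c + 1 ≠ bf s)) then P μ' ν' else 1)) s (ZMod.cast (∑ j, (a.1.1 + (fun i => ((z.1 i : ℤ) : ZMod L))) j) : ZMod w) (fun μ' ν' => plaquetteHolonomy V (a.1.1 + (fun i => ((z.1 i : ℤ) : ZMod L))) μ' ν'))) • vecQuat (((V (Site.shift a.1.1 a.1.2, ν) * (V (Site.shift a.1.1 ν, a.1.2))⁻¹ * (V (a.1.1, ν))⁻¹)⁻¹ : Matrix.specialUnitaryGroup (Fin 2) ℂ) : Matrix (Fin 2) (Fin 2) ℂ) +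
              ((fun s μ ν t F => κt / (2 * ((d - 1 : ℕ) : ℝ)) * Real.tanh (Ψ s μ ν t F)) s a.1.2 ν 1 (fun z : {z : Fin d → ℤ // ∀ i, |z i| ≤ ((m : ℕ) : ℤ)} =>
          (fun (s : σ) (c : ZMod w) (P : Fin d → Fin d → Matrix.specialUnitaryGroup (Fin 2) ℂ) => g s c (fun μ' ν' => if μ' ≠ ν' ∧ ((μf s ≠ μ' ∧ μf s ≠ ν') ∨ (c ≠ bf s ∧ c + 1 ≠ bf s)) then P μ' ν' else 1)) s (ZMod.cast (∑ j, (a.1.1 + (fun i => ((z.1 i : ℤ) : ZMod L))) j) : ZMod w) (fun μ' ν' => plaquetteHolonomy V (a.1.1 + (fun i => ((z.1 i : ℤ) : ZMod L))) μ' ν'))) • vecQuat ((((V (Site.shift (a.1.1 - Pi.single ν 1) a.1.2, ν))⁻¹ * (V (a.1.1 - Pi.single ν 1, a.1.2))⁻¹ * V (a.1.1 - Pi.single ν 1, ν))⁻¹ : Matrix.specialUnitaryGroup (Fin 2) ℂ) : Matrix (Fin 2) (Fin 2) ℂ))) (vecQuat ((V a.1 : Matrix.specialUnitaryGroup (Fin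 2) ℂ) : Matrix (Fin 2) (Fin 2) ℂ)))))) ∧
      ∃ hΦ : Measurable (fun (V : GaugeConfig d L (Matrix.specialUnitaryGroup (Fin 2) ℂ)) (l : Edge d L) => κ • WithLp.toLp 2 (fun i : Fin 3 =>
        fderiv ℝ (fun a : Edge d L → EuclideanSpace ℝ (Fin 3) => β * wilsonAction (Matrix.specialUnitaryGroup (Fin 2) ℂ).subtype ((layers.foldr (fun Ly (F : GaugeConfig d L (Matrix.specialUnitaryGroup (Fin 2) ℂ) ≃ᵐ GaugeConfig d L (Matrix.specialUnitaryGroup (Fin 2) ℂ)) => Ly.1.trans F) (MeasurableEquiv.refl (GaugeConfig d L (Matrix.specialUnitaryGroup (Fin 2) ℂ)))) ((fun l : Edge d L => expPauli (a l)) * V)) - Real.log ((layers.foldr (fun Ly K => fun v => Ly.2 v * K (Ly.1 v)) (fun _ => (1 : ℝ))) ((fun l : Edge d L => expPauli (a l)) * V))) 0 (Pi.single l (EuclideanSpace.single i (1 : ℝ))))),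
      ∀ (n : ℕ) (ε' : ℝ) (_hn : 1 ≤ n) (_hε' : 0 < ε'), n * ε' ≤ τ₀ →
        ∃ k : ℕ, ∃ δ : ℝ, 0 < δ ∧ δ ≤ 1 ∧ ∀ (μ₀ : Measure (GaugeConfig d L (Matrix.specialUnitaryGroup (Fin 2) ℂ))) [IsProbabilityMeasure μ₀] (t : ℕ) (A : Set (GaugeConfig d L (Matrix.specialUnitaryGroup (Fin 2) ℂ))),
          |((fun m : Measure (GaugeConfig d L (Matrix.specialUnitaryGroup (Fin 2) ℂ)) =>
                m.bind (conjKernel (su2LeapfrogHMCN ε' κ' (measurable_halfKick_su2 hΦ ε')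
                  (fun V : GaugeConfig d L (Matrix.specialUnitaryGroup (Fin 2) ℂ) => β * wilsonAction (Matrix.specialUnitaryGroup (Fin 2) ℂ).subtype ((layers.foldr (fun Ly (F : GaugeConfig d L (Matrix.specialUnitaryGroup (Fin 2) ℂ) ≃ᵐ GaugeConfig d L (Matrix.specialUnitaryGroup (Fin 2) ℂ)) => Ly.1.trans F) (MeasurableEquiv.refl (GaugeConfig d L (Matrix.specialUnitaryGroup (Fin 2) ℂ)))) V) - Real.log ((layers.foldr (fun Ly K => fun v => Ly.2 v * K (Ly.1 v)) (fun _ => (1 : ℝ))) V)) n) (layers.foldr (fun Ly (F : GaugeConfig d L (Matrix.specialUnitaryGroup (Fin 2) ℂ) ≃ᵐ GaugeConfig d L (Matrix.specialUnitaryGroup (Fin 2) ℂ)) => Ly.1.trans F) (MeasurableEquiv.refl (GaugeConfig d L (Matrix.specialUnitaryGroup (Fin 2) ℂ))))))^[t] μ₀).real A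
            - (wilsonMeasure (Matrix.specialUnitaryGroup (Fin 2) ℂ).subtype β).real A| ≤ (1 - δ) ^ (t / (k + 1)) :=
  su2ResidualSmoothStencil_member_fthmcN_exactForce_uniformlyErgodic_allVolumes (d := d) w μf bf cf m
    (fun (s : σ) (c : ZMod w) (P : Fin d → Fin d → Matrix.specialUnitaryGroup (Fin 2) ℂ) => g s c (fun μ' ν' => if μ' ≠ ν' ∧ ((μf s ≠ μ' ∧ μf s ≠ ν') ∨ (c ≠ bf s ∧ c + 1 ≠ bf s)) then P μ' ν' else 1))
    Ψ hκt hκ0 hκ₀ hcκ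
    (maskedFeature_differentiable w μf bf g hgD) (maskedFeature_contDiff w μf bf g hgC) hΨD hΨC
    (maskedFeature_measurable w μf bf g hgm) hΨm (maskedFeature_frozen w μf bf g) sched β κ hκ'

end Masked

end Summit.Ventures.LatticeQCDFlow.Exactness
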